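import Summits.RiemannHypothesis.RiemannHypothesis.Theses.ConnesConsaniSemilocal
import Summits.RiemannHypothesis.RiemannHypothesis.Theorems.CCIsolation
import Literature.NumberTheory.ConnesConsani2021.ArchimedeanTraceFormula
import HarnessLib

/-!
# Route «ConnesConsaniSemilocal»: adapters between the items' inline texts and the corpus vocabulary

RH-FREE bookkeeping (cell `rh-crit`, sub-cell `cc/`, seat `rh-crit-cc-iso`, row O9 of `cc/STATUS.md`
2026-08-26T04:10:21Z; bears_on: W-C/W-P).  The route file
`Summits/RiemannHypothesis/RiemannHypothesis/Theses/ConnesConsaniSemilocal.lean` (rev 1, born 04:03:52Z, v1 texts)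
types its four RH-FREE corpus items K0 `DensityRegular`, K1 `SoninTraceFormula`, K2 `DensitySlope`,
K3 `WindowSpectralBound` over an INLINE density predicate — "`G` agrees on `[0, ∞)` with the prolate series
`x ↦ Σ_n λ(n)(1 − λ(n)²)⁻¹ ⟨ψ_n | ϑ(e^{−x}) ψ_n^P⟩`, `λ(n) = (∫ψ_n)/ψ_n(0)`, `ψ_n^P = 1_{|v| ≥ 1}·𝓕ψ_n`" — because at
birth the corpus decl did not exist yet.  Seat t4 has since landed that vocabulary in
`Literature/NumberTheory/ConnesConsani2021/ArchimedeanTraceFormula.lean`: `prolateLambda`, `prolateCutFourier`,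
`epsTerm`, `epsDensity`, the predicate `IsArchDensity G := ∀ ψ prolate family, ∀ x ≥ 0, G x = epsDensity ψ x`, and the
named fact `CC2021_thm_4_7_weak` (Connes–Consani 2021 Thm. 4.7, weak trace form).

This file proves that the inline texts and the corpus vocabulary AGREE DEFINITIONALLY (the only rewriting is
`|x| = x` for `x ≥ 0` inside `epsDensity`), so that every closer lands its theorem in Literature vocabulary and the
route item closes by ONE line `…_iff.mpr <Literature theorem>`:

* `epsDensity_eq_routeSeries`, `routeDensity_iff_isArchDensity` — the inline predicate IS `IsArchDensity`;
* `densityRegular_iff` (K0), `soninTraceFormula_iff_thm_4_7_weak` (K1 IS t4's `CC2021_thm_4_7_weak`, by name),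
  `densitySlope_iff` (K2), `windowSpectralBound_iff` (K3 = the (H-op) shape of
  `weilArchPositivity_soninTrace_fine_of_opIneq` over `IsArchDensity`);
* `leaf_of_corpusShapes` — end-to-end check: the four corpus shapes give the RH-FREE leaf through the transports and
  ONE application of the route's `closes`;
* `isolatedCC_iff_ccIsolation` — the route's aside `IsolatedCC` (item -19309, RH-EQUIVALENT l.1, never a binder)
  IS the cell's residual of record `Theorems.CCIsolation.IsolatedCC` (`Iff.rfl`);
* VACUITY GUARD (lead's audit, recorded as a theorem): the predicate binds `x ≥ 0` ONLY; an all-`x` reading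
  `∀ x, G x = epsDensity ψ x` forces `deriv G 0 = 0` (`epsDensity` is even), which is incompatible with K2's
  `22.9 ≤ Re G′(0)` (`deriv_zero_eq_zero_of_forall_eq_epsDensity`, `not_densitySlope_bound_of_forall_eq_epsDensity`) —
  so K0 ∧ K2 are jointly satisfiable only because of the half-line reading, as typed.

WHAT THIS IS NOT: any mathematics of the corpus (no item is proved here), any claim about RH; the leaf
`WeilArchPositivity_soninTrace_fine` is RH-FREE and not RH-detecting; the residual `IsolatedCC` is RH-EQUIVALENT and
untouched.  No defs, no named facts, standard axioms.  Nothing here bears on the truth of RH.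
-/

set_option linter.dupNamespace false  -- the mandated namespace repeats `RiemannHypothesis`

noncomputable section

open Set Complex MeasureTheory FourierTransform
open scoped InnerProductSpace
open Literature.NumberTheory.LFunctions Literature.NumberTheory.ConnesConsani2021

namespace Summit.RiemannHypothesis.RiemannHypothesis.Theorems.CCRouteAdapters

/-! ## The inline density predicate IS `IsArchDensity` -/

/-- RH-FREE. On `x ≥ 0`, t4's `epsDensity ψ x = Σ'_n epsTerm (ψ n) |x|` is LITERALLY the route's inline prolate
series (unfold `epsTerm`, `prolateLambda`, `prolateCutFourier`; `|x| = x`). [cite: ConnesConsani2021, Thm. 4.7 eq. (sonine0) §4 p. 18; §5 eq. (Eprime) p. 20] -/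
theorem epsDensity_eq_routeSeries (ψ : ℕ → ℝ → ℝ) {x : ℝ} (hx : 0 ≤ x) :
    epsDensity ψ x = ∑' n : ℕ, ((((∫ v, ψ n v) / ψ n 0) / (1 - ((∫ v, ψ n v) / ψ n 0) ^ 2) : ℝ) : ℂ) *
      scalingCoeff (fun v => ((ψ n v : ℝ) : ℂ))
        (fun v => if 1 ≤ |v| then 𝓕 (fun u : ℝ => ((ψ n u : ℝ) : ℂ)) v else 0) (-x) := by
  rw [epsDensity, abs_of_nonneg hx]
  rfl

/-- RH-FREE. **The route's inline density predicate ("`G` = the prolate series on `[0, ∞)` for every even prolate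
family") is t4's `IsArchDensity G`** — definitionally, up to `|x| = x` on `x ≥ 0`. [cite: ConnesConsani2021, §5 eq. (Eprime) p. 20; Thm. 4.7 §4 p. 18] -/
theorem routeDensity_iff_isArchDensity (G : ℝ → ℂ) :
    (∀ ψ : ℕ → ℝ → ℝ, (∀ n, IsProlateFunction 1 (2 * n) (ψ n)) → ∀ x : ℝ, 0 ≤ x →
        G x = ∑' n : ℕ, ((((∫ v, ψ n v) / ψ n 0) / (1 - ((∫ v, ψ n v) / ψ n 0) ^ 2) : ℝ) : ℂ) *
          scalingCoeff (fun v => ((ψ n v : ℝ) : ℂ))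
            (fun v => if 1 ≤ |v| then 𝓕 (fun u : ℝ => ((ψ n u : ℝ) : ℂ)) v else 0) (-x)) ↔
      IsArchDensity G := by
  refine forall₂_congr fun ψ _ ↦ forall₂_congr fun x hx ↦ ?_
  rw [epsDensity_eq_routeSeries ψ hx]

/-! ## The four transports (route item ↔ corpus shape) -/

/-- RH-FREE. **K0 transport**: `DensityRegular ↔ ∃ G ∈ C²(ℝ), IsArchDensity G`. [cite: ConnesConsani2021, Lemma 5.2 / Prop. 5.3 §5 pp. 19–20 and App. E] -/
theorem densityRegular_iff :
    Theses.ConnesConsaniSemilocal.DensityRegular ↔ ∃ G : ℝ → ℂ, ContDiff ℝ 2 G ∧ IsArchDensity G :=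
  exists_congr fun G ↦ and_congr_right fun _ ↦ routeDensity_iff_isArchDensity G

/-- RH-FREE. K0 from the corpus shape: any `C²` archimedean density closes `DensityRegular`. [cite: ConnesConsani2021, Lemma 5.2 / Prop. 5.3 §5 pp. 19–20] -/
theorem densityRegular_of_isArchDensity {G : ℝ → ℂ} (hG : ContDiff ℝ 2 G) (h : IsArchDensity G) :
    Theses.ConnesConsaniSemilocal.DensityRegular :=
  densityRegular_iff.2 ⟨G, hG, h⟩

/-- RH-FREE. **K1 transport: the route's `SoninTraceFormula` IS t4's named fact `CC2021_thm_4_7_weak`**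
(Connes–Consani 2021 Thm. 4.7, weak trace form, for every archimedean density). [cite: ConnesConsani2021, Thm. 4.7 §4 p. 18 (= arXiv Thm. 27); Thm. 6.11 proof §6.7 p. 29] -/
theorem soninTraceFormula_iff_thm_4_7_weak :
    Theses.ConnesConsaniSemilocal.SoninTraceFormula ↔ CC2021_thm_4_7_weak :=
  forall_congr' fun G ↦ imp_congr (routeDensity_iff_isArchDensity G) Iff.rfl

/-- RH-FREE. K1 closes the moment `CC2021_thm_4_7_weak` is discharged (FRONTIER by design: this is where the
corpus's deep analytic input sits). [cite: ConnesConsani2021, Thm. 4.7 §4 p. 18] -/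
theorem soninTraceFormula_of_thm_4_7_weak (h : CC2021_thm_4_7_weak) :
    Theses.ConnesConsaniSemilocal.SoninTraceFormula :=
  soninTraceFormula_iff_thm_4_7_weak.2 h

/-- RH-FREE. **K2 transport**: `DensitySlope ↔` "for every `C²` archimedean density `G`, `G′(0)` is real with
`22.9 ≤ G′(0) ≤ 23.1`" (Lemma 5.4: `ε′(1₊) ≃ 22.9965`). [cite: ConnesConsani2021, Lemma 5.4 §5 p. 20 (= arXiv Lemma 31)] -/
theorem densitySlope_iff :
    Theses.ConnesConsaniSemilocal.DensitySlope ↔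
      ∀ G : ℝ → ℂ, ContDiff ℝ 2 G → IsArchDensity G →
        (deriv G 0).im = 0 ∧ (22.9 : ℝ) ≤ (deriv G 0).re ∧ (deriv G 0).re ≤ 23.1 :=
  forall_congr' fun G ↦ imp_congr_right fun _ ↦ imp_congr (routeDensity_iff_isArchDensity G) Iff.rfl

/-- RH-FREE. **K3 transport**: `WindowSpectralBound ↔` the sign-free operator inequality (H-op) of
`weilArchPositivity_soninTrace_fine_of_opIneq` — for every `C²` archimedean density `G` some `a₀ ∈ [0, 0.0635]`
with `⟨ξ|(1 − 𝐊_I)ξ⟩ + a₀|⟨η₀|ξ⟩|² ≥ 0` on `L²(I)`, `I = [−½ log 2, ½ log 2]`. [cite: ConnesConsani2021, §6 Lemmas 6.3/6.4/6.8/6.9 and Thm. 6.11 §6.7 pp. 24–29] -/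
theorem windowSpectralBound_iff :
    Theses.ConnesConsaniSemilocal.WindowSpectralBound ↔
      ∀ (G : ℝ → ℂ) (hG : ContDiff ℝ 2 G), IsArchDensity G →
        ∃ a₀ : ℝ, 0 ≤ a₀ ∧ a₀ ≤ 0.0635 ∧
          ∀ ξ : Lp ℂ 2 ((volume : Measure ℝ).restrict (Icc (-(Real.log 2 / 2)) (Real.log 2 / 2))),
            0 ≤ RCLike.re ⟪ξ, ξ - windowOp (-(Real.log 2 / 2)) (Real.log 2 / 2) (integrableOn_varpi hG _ _) ξ⟫_ℂ
                  + a₀ * ‖⟪constVector (-(Real.log 2 / 2)) (Real.log 2 / 2), ξ⟫_ℂ‖ ^ 2 :=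
  forall₂_congr fun G _ ↦ imp_congr (routeDensity_iff_isArchDensity G) Iff.rfl

/-- RH-FREE. **End-to-end check: the route's deciding theorem `closes` in corpus vocabulary** — the four
Literature-side shapes (a `C²` archimedean density; t4's `CC2021_thm_4_7_weak`; the slope enclosure; the (H-op)
window inequality) give the RH-FREE rung leaf `WeilArchPositivity_soninTrace_fine` through the four transports and
ONE application of `Theses.ConnesConsaniSemilocal.closes` (same content as t4's
`weilArchPositivity_soninTrace_fine_of_thm_4_7_weak_of_opIneq`; recorded to certify that the adapters compose).  The
leaf is NOT RH-detecting. [cite: ConnesConsani2021, eq. (4) p. 4 and Thm. 6.11 §6.7 pp. 28–29] -/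
theorem leaf_of_corpusShapes (h₀ : ∃ G : ℝ → ℂ, ContDiff ℝ 2 G ∧ IsArchDensity G) (h₁ : CC2021_thm_4_7_weak)
    (h₂ : ∀ G : ℝ → ℂ, ContDiff ℝ 2 G → IsArchDensity G →
      (deriv G 0).im = 0 ∧ (22.9 : ℝ) ≤ (deriv G 0).re ∧ (deriv G 0).re ≤ 23.1)
    (h₃ : ∀ (G : ℝ → ℂ) (hG : ContDiff ℝ 2 G), IsArchDensity G →
      ∃ a₀ : ℝ, 0 ≤ a₀ ∧ a₀ ≤ 0.0635 ∧
        ∀ ξ : Lp ℂ 2 ((volume : Measure ℝ).restrict (Icc (-(Real.log 2 / 2)) (Real.log 2 / 2))),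
          0 ≤ RCLike.re ⟪ξ, ξ - windowOp (-(Real.log 2 / 2)) (Real.log 2 / 2) (integrableOn_varpi hG _ _) ξ⟫_ℂ
                + a₀ * ‖⟪constVector (-(Real.log 2 / 2)) (Real.log 2 / 2), ξ⟫_ℂ‖ ^ 2) :
    WeilArchPositivity_soninTrace_fine :=
  Theses.ConnesConsaniSemilocal.closes (densityRegular_iff.2 h₀) (soninTraceFormula_iff_thm_4_7_weak.2 h₁)
    (densitySlope_iff.2 h₂) (windowSpectralBound_iff.2 h₃)

/-! ## The aside and the assembly text -/

/-- RH-EQUIVALENT (line 1; aside, never a binder, never a proving target). The route's `IsolatedCC` (item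
stmt-RiemannHypothesis-19309) IS the cell's residual of record `Theorems.CCIsolation.IsolatedCC` — both are
`∀ n, weilPropertyP n` (`Iff.rfl`); hence `↔ RH` by `CCIsolation.isolatedCC_iff_riemannHypothesis`.
[cite: Connes2026Letter, §4.1 p. 17; ConnesConsani2021 Intro p. 3] -/
theorem isolatedCC_iff_ccIsolation :
    Theses.ConnesConsaniSemilocal.IsolatedCC ↔ CCIsolation.IsolatedCC := Iff.rfl

/-- RH-EQUIVALENT (line 1). The route's aside in RH form: `Theses.….IsolatedCC ↔ RiemannHypothesis` (cited kernel
`ConnesPropertyP.riemannHypothesis_iff_forall_weilPropertyP`; both directions tree theorems). [cite: Connes2026Letter, §4.1 p. 17; Bombieri2000Weil Thms. 1–2] -/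
theorem routeIsolatedCC_iff_riemannHypothesis :
    Theses.ConnesConsaniSemilocal.IsolatedCC ↔ _root_.RiemannHypothesis :=
  CCIsolation.isolatedCC_iff_riemannHypothesis

/-! ## Vacuity guard: why the density predicate binds `x ≥ 0` only -/

/-- RH-FREE. If `G` agreed with `epsDensity ψ` for ALL `x` (not only `x ≥ 0`), then `G` is even and `G′(0) = 0`
(`epsDensity_neg`; `deriv_comp_neg` needs no differentiability). [cite: ConnesConsani2021, Lemma 5.4 §5 p. 20 (ε′(1₊) ≠ 0: ε∘exp∘|·| has a corner at 0)] -/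
theorem deriv_zero_eq_zero_of_forall_eq_epsDensity {G : ℝ → ℂ} {ψ : ℕ → ℝ → ℝ}
    (h : ∀ x, G x = epsDensity ψ x) : deriv G 0 = 0 := by
  have hG : (fun x => G (-x)) = G := funext fun x => by rw [h, h, epsDensity_neg]
  have h2 : deriv G 0 = -deriv G 0 := by
    conv_lhs => rw [← hG]
    rw [deriv_comp_neg, neg_zero]
  linear_combination (1 / 2 : ℂ) * h2

/-- RH-FREE. **Vacuity guard** (cell lead's audit, cc/STATUS 04:10:21Z (c)): under an all-`x` reading of the
density predicate, K2's lower bound `22.9 ≤ Re G′(0)` FAILS for every admissible `G` — so K0 ∧ K2 would be jointly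
unsatisfiable; with the half-line reading AS TYPED they are consistent (any `C²` extension of `ε∘exp|_{[0,∞)}` has
`G′(0) = ε′(1₊) ≃ 22.9965`). [cite: ConnesConsani2021, Lemma 5.4 §5 p. 20] -/
theorem not_densitySlope_bound_of_forall_eq_epsDensity {G : ℝ → ℂ} {ψ : ℕ → ℝ → ℝ}
    (h : ∀ x, G x = epsDensity ψ x) : ¬ ((22.9 : ℝ) ≤ (deriv G 0).re) := by
  rw [deriv_zero_eq_zero_of_forall_eq_epsDensity h, Complex.zero_re]
  norm_num

end Summit.RiemannHypothesis.RiemannHypothesis.Theorems.CCRouteAdapters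

end
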